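import Summits.BirchSwinnertonDyer.BirchSwinnertonDyer.Theorems.ByReductionTypeAtTwoMultTransportTwistedDescentGenericDualTwo
import Summits.BirchSwinnertonDyer.BirchSwinnertonDyer.Theorems.ByReductionTypeAtTwoMultTransportTwistedDescentLevelDualLine
import HarnessLib

/-!
# T-42 in the kernel, LXXVII — road (S-C′), brick B2′: the DUAL-SIDE change of level `H¹(ι^D) y = 0` from the
# LOCAL dual Kummer condition at a place carrying a Greenberg line, on models with no rational `p`-torsion point
# on the line (replaces the omitted-prime input `hv₀/σ₂/hf` of the engine XXIV-b′)

Cell `bsd-2adic` (run/shared/lean/pub/bsd-2adic/), seat `bsd-2adic-t42` GEN 32 (pen RC-521 «(S-C′) FUNDED», memo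
`t42/DESIGN-T42-ADDENDUM-35.md` §A35.2 (O-2), §A35.8 (ii) and B2′; audit-2 D-NOTE SC-NEG@2 §4 (R-ker)). HONEST FRAMING: research
route; THEOREMS ONLY (no `def`, no named fact, no instance, no `sorry`); nothing booked; no door or class file is touched; BSD is
not proved by any of this. PARTITION: X5@2 multiplicative GV-transport rows (K4ᵐ B1·O1; the PRINT binder F1) × p = 2 —
reduces-the-named-input-of; bears_on K4 items 19922 / 19923 (`--supports stmt-BirchSwinnertonDyer-19923`).

## What

In the engine `exists_target_orthogonal_alt` (XXIV-b′) the Poitou–Tate obstruction `⟨H¹(ι) t'_v, y_v⟩_v = ⟨t'_v, loc_v H¹(ι^D) y⟩_v`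
is killed by `H¹(ι^D) y = 0`, obtained in `ZpExtensionGaloisTwistLevelDualProofs` from the STRICT dual condition at an omitted prime
`v₀ ∈ S₀` (`res_{v₀} y = 0`) — useless once the targets at `S₀` are prescribed (LXXVI: the dual condition at `S₀` is then
EVERYTHING). Here `H¹(ι^D) y = 0` is derived instead from the dual Kummer condition of `y` AT THE PLACE `v` ABOVE `p`
(which every dual Selmer class satisfies) — Greenberg p. 122 read LITERALLY (parity-free core `coker(γ)^ ≅ β(S_{T*}(F))`,
audit-2 D-NOTE): with `p^{J−j} · y = 0` the cocycle of `y = H¹(w) y'` satisfies `p^{J−j} φ' = ∂Q` (`Q ∈ E[p^J]`, `u'`-twisted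
action), and `R := p^j Q` is a `u'`-twisted `Γ_K`-INVARIANT of `E[p^J]` — the finite-level avatar of `M*(F) = A_{−s}(F) ∋ E(F)[p]`;
the question is whether `R = 0`.

Tools (sibling LXXVII-a `…TwistedDescentLevelDualLine`): §1 the cocycle tail `map_twistedTorsionInclDual_oneCocycleClass_eq_zero`
(`p^{J−j} φ = ∂m`, `p^j m = 0` ⟹ `H¹(ι^D)[φ] = 0`); §2 the NEW LOCAL INPUT `pow_natAbs_smul_eq_zero_of_homRep_line_apply_eq_self`
(`σ₀`-fixed elements of `Hom(C(χ_u), μ_{p^J})` are killed by `p^{|u−1|}`, `σ₀` inertial over the topological generator acting on the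
line through its `μ`-exponent — package (iv)); §3 the model hypothesis from its `p`-torsion form.

* **`map_twistedTorsionInclDual_map_twistedWeilDual_eq_zero_of_dualKummer_line`** — B2′ + the dual-side change of level:
  `K` a number field, `j ≤ J` with `|u − 1| ≤ j`, `u ≠ 1`, `u u' ≡ 1 (mod p^J)`, `e` an alternating non-degenerate Weil pairing at
  level `p^J`, a line datum `N` at `v` with (d) divisible, (c) `#C[p] = p`, (i) `C`-valued cocycles Kummer (LXIV's currency),
  `σ₀` as in §2, and the MODEL HYPOTHESIS «every `u'`-twisted `Γ_K`-invariant point of `E[p^J]` on the line is `0`»; then for a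
  GLOBAL `y' ∈ H¹(Γ_K, E[p^J](χ_{u'}))` with `p^{J−j} · y' = 0` whose localisation at `v` pairs to zero with the kernel of
  `twistedTorsionToLocalH1^{(u)}` (the dual local condition `𝓕_v^*` of `y = H¹(w) y'`), `H¹(ι^D)(H¹(w) y') = 0`.
  PROOF. (1) `p^{J−j} φ' = ∂Q`. (2) At `v`, LXIV's steps verbatim: line classes die under `twistedTorsionToLocalH1`, so by local
  Tate duality for `C(χ_u)` the class `H¹(θ)(res_v y') = 0`, `θ : E[p^J](χ_{u'}) → Hom(C(χ_u), μ)`, `(θ m) c = e(c, m)`; on cocycles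
  `θ(φ'(σ)) = σ⋆n₀ − n₀`. (3) `θ(Q) − p^{J−j} n₀` is `σ`-fixed, so (§2) `p^{|u−1|}(θ Q − p^{J−j} n₀) = 0`, whence `p^j θ(Q) = p^J n₀ = 0`:
  `e(c, R) = 1` for all `c ∈ C_J`, i.e. (maximal isotropy, XXVIII) **`R ∈ C_J`** — audit-2's «`δ₂(P₀) ∈ 𝓕₂^⊥ ⟺ P₀ ∈ C₂`» at finite
  level. (4) `R` is twisted-invariant (`g⋆R − R = p^J φ'(g) = 0`), so the model hypothesis gives `R = 0`, `p^j · w(Q) = 0`, and §1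
  with `m = w(Q)` concludes.
The model hypothesis is supplied at every level and twist from its `p`-torsion form by LXXVII-a §3 (for `E/ℚ` with
`E(ℚ)[2] = {0, P₀}`: «`P₀ ∉ C₂`», k5 — the displayed `x(P₀) ∈ ℤ₂` of the Tate-curve rows; vacuous when `E(K)[p] = 0`).

Not here: the engine re-assembly (sibling `…TwistedDescentStrictEngine`), the Tate-line / reduction-datum instances of §2's `σ₀`
clause (suppliers XXXIV `exists_mem_absInertia_kappa_resGal_eq` + XXXVII (iv) / LXIII `reductionDatum_inertia_smul_eq`).

References: [GreenbergLNM1716] §2 pp. 74–76, §4 Prop. 4.13 and pp. 121–125; [GreenbergVatsal2000] §2 pp. 17–19;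
[MilneADT2006] I Cor. 2.3, I §6; [SerreGaloisCohomology1997] I §2.2, II §5.2; [SilvermanAEC2009] III.8.1.
-/

set_option autoImplicit false
set_option linter.dupNamespace false

noncomputable section

open scoped Classical AddSubgroup ContRepresentation

namespace Summit.BirchSwinnertonDyer.BirchSwinnertonDyer.Theorems.MultTransportTwistedDescent

open NumberField IsDedekindDomain Field WeierstrassCurve CategoryTheory Function
  Literature.NumberTheory.GaloisRepresentations Literature.NumberTheory.EllipticCurves
  Literature.NumberTheory.EllipticCurves.GreenbergSelmer IsDedekindDomain.HeightOneSpectrum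
  Summit.BirchSwinnertonDyer.Rank1Residual.X2 ContinuousCohomology
open Literature.NumberTheory.GaloisRepresentations.DiscreteGaloisModule (localTatePairingZMod localTatePairing
  TateDual tateDual mu MuCarrier)

/-! ## B2′: `H¹(ι^D)(H¹(w) y') = 0` from the dual Kummer condition at the line and the model hypothesis -/

section Main

variable {K : Type} [Field K] [NumberField K] (W : WeierstrassCurve K) [W.IsElliptic] (p : ℕ)
  [hp : Fact p.Prime] (κ : ZpExtension K p) {j J : ℕ} (hjJ : j ≤ J) {u u' : ℤ} (hu : (p : ℤ) ∣ u - 1)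
  (hu' : (p : ℤ) ∣ u' - 1) (huu' : ((p : ℤ) ^ J) ∣ u * u' - 1)
  (e : W.geomTorsion ((p ^ J : ℕ) : ℤ) → W.geomTorsion ((p ^ J : ℕ) : ℤ) → AlgebraicClosure K)
  (hμ : ∀ S T, e S T ^ (p ^ J) = 1)
  (hadd₁ : ∀ S₁ S₂ T, e (S₁ + S₂) T = e S₁ T * e S₂ T)
  (hadd₂ : ∀ S T₁ T₂, e S (T₁ + T₂) = e S T₁ * e S T₂)
  (hgal : ∀ (σ : absoluteGaloisGroup K) (S T : W.geomTorsion ((p ^ J : ℕ) : ℤ)),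
    σ • e S T = e (σ • S) (σ • T))
  (halt : ∀ T, e T T = 1) (hnondeg : ∀ T, (∀ S, e S T = 1) → T = 0)
  [Finite (W.geomTorsion ((p ^ j : ℕ) : ℤ))] [Finite (W.geomTorsion ((p ^ J : ℕ) : ℤ))]

include halt hnondeg in
set_option maxHeartbeats 800000 in
/-- **B2′ — the dual-side change of level from the LOCAL dual Kummer condition at a line and the model hypothesis** (see the module
docstring for the statement and the four-step proof; `hmod` is the displayed MODEL HYPOTHESIS «no `u'`-twisted `Γ_K`-invariant point
of `E[p^J]` lies on the line», §4; `hσ₀C` is the Tate-line / reduction-datum package clause (iv) for the inertial `σ₀` of XXXIV;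
`hju : |u − 1| ≤ j` is the engine's level bookkeeping; granted the divisibility of `E(K̄)`).
[cite: GreenbergLNM1716, §4 Prop. 4.13 and pp. 121–125] [cite: MilneADT2006, Ch. I, Cor. 2.3 and §6]
[cite: GreenbergVatsal2000, §2 pp. 17–19] [cite: SilvermanAEC2009, Prop. III.8.1] -/
theorem map_twistedTorsionInclDual_map_twistedWeilDual_eq_zero_of_dualKummer_line
    (hdivE : W.zsmul_geomPoints_surjective) (hju : (u - 1).natAbs ≤ j) (hu1 : u ≠ 1)
    (v : HeightOneSpectrum (𝓞 K)) (N : LocalDatum K (W.geomPrimaryTorsion p) v)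
    (hdiv : ∀ c ∈ N.plus, ∃ c' ∈ N.plus, p • c' = c)
    (hcard : Nat.card ↥(N.plus ⊓ (↥(W.geomPrimaryTorsion p))[(p : ℤ)]) = p)
    (hKum : ∀ (f : localSubgroup κ.kerSubgroup (v.adicCompletion K) → W.geomPrimaryTorsion p),
      (∀ τ, f τ ∈ N.plus) → Continuous f →
      (∀ τ₁ τ₂, f (τ₁ * τ₂) = f τ₁ + resGal (K := K) (v.adicCompletion K)
        (τ₁ : absoluteGaloisGroup (v.adicCompletion K)) • f τ₂) →
      ∃ Q : localPoints W (v.adicCompletion K),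
        ∀ τ : localSubgroup κ.kerSubgroup (v.adicCompletion K),
          pointsMap W (v.adicCompletion K) (f τ : W.geomPoints) =
            (τ : absoluteGaloisGroup (v.adicCompletion K)) • Q - Q)
    (σ₀ : absoluteGaloisGroup (v.adicCompletion K))
    (hσ₀ : κ (resGal (K := K) (v.adicCompletion K) σ₀) = Multiplicative.ofAdd 1)
    (hσ₀C : ∀ a : ℕ, (∀ ζ : (AlgebraicClosure (v.adicCompletion K))ˣ, ζ ^ p ^ J = 1 →
        Units.map (Field.absoluteGaloisGroup.toAlgEquiv (v.adicCompletion K) σ₀ :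
          AlgebraicClosure (v.adicCompletion K) →* AlgebraicClosure (v.adicCompletion K)) ζ = ζ ^ a) →
      ∀ c : W.geomTorsion ((p ^ J : ℕ) : ℤ), AddSubgroup.inclusion
        (Literature.Barriers.BirchSwinnertonDyer.geomTorsion_pow_le_geomPrimaryTorsion W p J) c ∈ N.plus →
        absGaloisRestrict K (v.adicCompletion K) σ₀ • c = a • c)
    (hmod : ∀ R : W.geomTorsion ((p ^ J : ℕ) : ℤ), AddSubgroup.inclusion
        (Literature.Barriers.BirchSwinnertonDyer.geomTorsion_pow_le_geomPrimaryTorsion W p J) R ∈ N.plus →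
      (∀ g : absoluteGaloisGroup K, W.twistedTorsionGaloisModule p κ J u' hu' g R = R) → R = 0)
    (ιv : galoisCohomology ((mu K (p ^ J)).toLocal (Sum.inr v)) 2 →+ ZMod (p ^ J)) (hι : Injective ιv)
    (y' : galoisCohomology (W.twistedTorsionGaloisModule p κ J u' hu') 1)
    (hy : (p ^ (J - j)) • y' = 0)
    (H : ∀ a : galoisCohomology ((W.twistedTorsionGaloisModule p κ J u hu).restrictField (v.adicCompletion K)) 1,
      W.twistedTorsionToLocalH1 p κ J u hu (v.adicCompletion K) a = 0 →
      localTatePairingZMod (W.twistedTorsionGaloisModule p κ J u hu) (p ^ J) (Sum.inr v) ιv a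
        (galoisCohomology.map
          ((W.twistedWeilDual p κ J hu hu' huu' e hμ hadd₁ hadd₂ hgal).restrictField (v.adicCompletion K)) 1
          (galoisCohomology.res (W.twistedTorsionGaloisModule p κ J u' hu') (v.adicCompletion K) 1 y')) = 0) :
    galoisCohomology.map (W.twistedTorsionInclDual p κ hjJ u hu) 1
      (galoisCohomology.map (W.twistedWeilDual p κ J hu hu' huu' e hμ hadd₁ hadd₂ hgal) 1 y') = 0 := by
  haveI : NeZero (p ^ J) := ⟨pow_ne_zero _ hp.out.ne_zero⟩
  haveI : CharZero K := charZero_of_injective_algebraMap (algebraMap ℚ K).injective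
  haveI : CharZero (v.adicCompletion K) := charZero_adicCompletion v
  haveI : CompactSpace (absoluteGaloisGroup (v.adicCompletion K)) :=
    absoluteGaloisGroup_compactSpace (v.adicCompletion K)
  set wJ := W.twistedWeilDual p κ J hu hu' huu' e hμ hadd₁ hadd₂ hgal with hwJ
  /- (1) the global coboundary identity `p^{J-j} φ' = ∂Q` -/
  obtain ⟨φ, rfl⟩ := oneCocycleClass_surjective _ y'
  have hs := oneCocycleClass_smul (W.twistedTorsionGaloisModule p κ J u' hu').toTopRep ((p ^ (J - j) : ℕ) : ℤ) φ
  conv at hs => rhs; rw [Nat.cast_smul_eq_nsmul]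
  have hy0 : oneCocycleClass (W.twistedTorsionGaloisModule p κ J u' hu').toTopRep (((p ^ (J - j) : ℕ) : ℤ) • φ) = 0 :=
    hs.trans hy
  rw [oneCocycleClass_eq_zero_iff] at hy0
  obtain ⟨Q, hQ⟩ := hy0
  have hQ' : ∀ g : absoluteGaloisGroup K, ((p ^ (J - j) : ℕ) : ℤ) • φ.1 g =
      W.twistedTorsionGaloisModule p κ J u' hu' g Q - Q := fun g ↦ hQ g
  /- (2) LXIV's local steps: the line, the duals, `θ`, `H¹(θ)(res_v y') = 0` -/
  let C : Submodule ℤ (W.geomTorsion ((p ^ J : ℕ) : ℤ)) :=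
    (N.plus.comap (AddSubgroup.inclusion
      (Literature.Barriers.BirchSwinnertonDyer.geomTorsion_pow_le_geomPrimaryTorsion W p J))).toIntSubmodule
  have hC : ∀ T, T ∈ C ↔ AddSubgroup.inclusion
      (Literature.Barriers.BirchSwinnertonDyer.geomTorsion_pow_le_geomPrimaryTorsion W p J) T ∈ N.plus :=
    fun T ↦ Iff.rfl
  have hCu : ∀ g, C ≤ C.comap
      (((W.twistedTorsionGaloisModule p κ J u hu).restrict (absGaloisRestrict K (v.adicCompletion K))) g) :=
    line_le_comap_twistedTorsionGaloisModule W p κ J u hu N C hC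
  have hCu' : ∀ g, C ≤ C.comap
      (((W.twistedTorsionGaloisModule p κ J u' hu').restrict (absGaloisRestrict K (v.adicCompletion K))) g) :=
    line_le_comap_twistedTorsionGaloisModule W p κ J u' hu' N C hC
  let RC := ((W.twistedTorsionGaloisModule p κ J u hu).restrict
      (absGaloisRestrict K (v.adicCompletion K))).subrepresentation C hCu
  let i := subtypeHom
    ((W.twistedTorsionGaloisModule p κ J u hu).restrict (absGaloisRestrict K (v.adicCompletion K))) C hCu
  let eD := (tateDualLocalIso v (W.twistedTorsionGaloisModule p κ J u hu) (p ^ J)).hom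
  let wF : ContinuousRep.toTopRep
      ((W.twistedTorsionGaloisModule p κ J u' hu').restrict (absGaloisRestrict K (v.adicCompletion K))) ⟶
      (((W.twistedTorsionGaloisModule p κ J u hu).tateDual (p ^ J)).restrict
        (absGaloisRestrict K (v.adicCompletion K))).toTopRep :=
    TopRep.ofHom ⟨(wJ.restrictField (v.adicCompletion K)).toContinuousLinearMap,
      (wJ.restrictField (v.adicCompletion K)).isIntertwining'⟩
  let iD : (((W.twistedTorsionGaloisModule p κ J u hu).restrict
        (absGaloisRestrict K (v.adicCompletion K))).homRep (mu (v.adicCompletion K) (p ^ J))).toTopRep ⟶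
      ((((W.twistedTorsionGaloisModule p κ J u hu).restrict
        (absGaloisRestrict K (v.adicCompletion K))).subrepresentation C hCu).homRep
          (mu (v.adicCompletion K) (p ^ J))).toTopRep :=
    ContinuousRep.homRepMap (mu (v.adicCompletion K) (p ^ J)) i
  let θ := wF ≫ eD ≫ iD
  have hθ_apply : ∀ (m' : W.geomTorsion ((p ^ J : ℕ) : ℤ)) (c : C),
      θ.hom m' c = muTransfer K (v.adicCompletion K) (p ^ J)
        (weilPairingHom W (p ^ J) e hμ hadd₁ hadd₂ (c : W.geomTorsion ((p ^ J : ℕ) : ℤ)) m') := fun _ _ ↦ rfl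
  -- classes from the line die under `twistedTorsionToLocalH1` (`u`-twist)
  have hBu : ∀ c : continuousCohomology 1 (((W.twistedTorsionGaloisModule p κ J u hu).restrict
      (absGaloisRestrict K (v.adicCompletion K))).subrepresentation C hCu).toTopRep,
      W.twistedTorsionToLocalH1 p κ J u hu (v.adicCompletion K) (cohomologyMap i 1 c) = 0 := fun c ↦ by
    obtain ⟨ξ, rfl⟩ := oneCocycleClass_surjective _ c
    rw [cohomologyMap_oneCocycleClass]
    exact twistedTorsionToLocalH1_oneCocycleClass_eq_zero_of_mem_line W p κ J u hu N C hC hKum _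
      (fun σ ↦ (ξ.1 σ).2)
  have hn : ∀ m : W.geomTorsion ((p ^ J : ℕ) : ℤ), (p ^ J) • m = 0 := fun m ↦ AddSubgroup.torsionBy.nsmul m
  have hnC : ∀ c : C, (p ^ J) • c = 0 := fun c ↦
    Subtype.ext (by rw [AddSubmonoidClass.coe_nsmul, ZeroMemClass.coe_zero]; exact hn _)
  -- the local class `res_v y'` and `H¹(θ)(res_v y') = 0`
  set yv := galoisCohomology.res (W.twistedTorsionGaloisModule p κ J u' hu') (v.adicCompletion K) 1
    (oneCocycleClass (W.twistedTorsionGaloisModule p κ J u' hu').toTopRep φ) with hyv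
  have hθ : cohomologyMap θ 1 yv = 0 := by
    obtain ⟨ι, -, -, hbf⟩ := localDuality_bijective (v.adicCompletion K)
      (((W.twistedTorsionGaloisModule p κ J u hu).restrict
        (absGaloisRestrict K (v.adicCompletion K))).subrepresentation C hCu) hnC
    refine hbf.1 (a₂ := 0) ?_
    rw [map_zero]
    refine AddMonoidHom.ext fun c ↦ ?_
    rw [AddMonoidHom.flip_apply, AddMonoidHom.zero_apply, cohomologyMap_comp_apply, cohomologyMap_comp_apply,
      ContinuousRep.dualityPairing_apply,
      ← ContPairing.cupProduct_adjoint
        ((((W.twistedTorsionGaloisModule p κ J u hu).restrict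
          (absGaloisRestrict K (v.adicCompletion K))).subrepresentation C hCu).evalPairing
            (mu (v.adicCompletion K) (p ^ J)))
        (((W.twistedTorsionGaloisModule p κ J u hu).restrict
          (absGaloisRestrict K (v.adicCompletion K))).evalPairing (mu (v.adicCompletion K) (p ^ J))) i iD
        (fun x f ↦ ContinuousRep.evalPairing_homRepMap (mu (v.adicCompletion K) (p ^ J)) i x f),
      ← ContinuousRep.dualityPairing_apply,
      ← iota_cupProduct_localPairingF v (W.twistedTorsionGaloisModule p κ J u hu) (p ^ J) ι]
    have h0 : (localPairingF v (W.twistedTorsionGaloisModule p κ J u hu) (p ^ J)).cupProduct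
        (cohomologyMap i 1 c) (cohomologyMap wF 1 yv) = 0 := by
      have h := H (cohomologyMap i 1 c) (hBu c)
      rw [DiscreteGaloisModule.localTatePairingZMod_apply] at h
      exact (injective_iff_map_eq_zero ιv).1 hι _ h
    rw [h0, map_zero, map_zero]
  /- (2') on cocycles: `θ(φ(σ|_K)) = σ ⋆ n₀ − n₀` -/
  have hθ' : ∃ n₀ : HomCarrier C (MuCarrier (v.adicCompletion K) (p ^ J)),
      ∀ σ : absoluteGaloisGroup (v.adicCompletion K),
        θ.hom (φ.1 (absGaloisRestrict K (v.adicCompletion K) σ)) =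
          (RC.homRep (mu (v.adicCompletion K) (p ^ J))) σ n₀ - n₀ := by
    rw [hyv, galoisCohomology.res_one_oneCocycleClass] at hθ
    erw [cohomologyMap_oneCocycleClass, oneCocycleClass_eq_zero_iff] at hθ
    obtain ⟨n₀, hn₀⟩ := hθ
    refine ⟨n₀, fun σ ↦ ?_⟩
    have h := hn₀ σ
    exact h
  obtain ⟨n₀, hn₀⟩ := hθ'
  /- (3) `d := θ Q − p^{J−j} n₀` is fixed by `σ₀`; hence `p^j θ Q = 0` -/
  have hθQ : ∀ σ : absoluteGaloisGroup (v.adicCompletion K),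
      (RC.homRep (mu (v.adicCompletion K) (p ^ J))) σ (θ.hom Q - ((p ^ (J - j) : ℕ) : ℤ) • n₀) =
        θ.hom Q - ((p ^ (J - j) : ℕ) : ℤ) • n₀ := by
    intro σ
    have hθz : ∀ (z : ℤ) (x : W.geomTorsion ((p ^ J : ℕ) : ℤ)), θ.hom (z • x) = z • θ.hom x :=
      fun z x ↦ map_zsmul θ.hom z x
    have h1 : θ.hom (((p ^ (J - j) : ℕ) : ℤ) • φ.1 (absGaloisRestrict K (v.adicCompletion K) σ)) =
        ((p ^ (J - j) : ℕ) : ℤ) • ((RC.homRep (mu (v.adicCompletion K) (p ^ J))) σ n₀ - n₀) := by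
      rw [hθz, hn₀ σ]
    have hcomm : θ.hom (W.twistedTorsionGaloisModule p κ J u' hu' (absGaloisRestrict K (v.adicCompletion K) σ) Q) =
        (RC.homRep (mu (v.adicCompletion K) (p ^ J))) σ (θ.hom Q) :=
      TopRep.hom_comm_apply θ σ Q
    have h2 : θ.hom (((p ^ (J - j) : ℕ) : ℤ) • φ.1 (absGaloisRestrict K (v.adicCompletion K) σ)) =
        (RC.homRep (mu (v.adicCompletion K) (p ^ J))) σ (θ.hom Q) - θ.hom Q := by
      rw [hQ', map_sub, hcomm]
    rw [map_sub, map_zsmul, sub_eq_sub_iff_sub_eq_sub, ← smul_sub]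
    exact (h1.symm.trans h2).symm
  have hkill := pow_natAbs_smul_eq_zero_of_homRep_line_apply_eq_self W p κ J u hu C hCu σ₀ hσ₀
    (fun a ha c hc ↦ hσ₀C a ha c ((hC c).1 hc)) hu1 _ (hθQ σ₀)
  have hJn₀ : p ^ J • n₀ = 0 := HomCarrier.ext fun c ↦ by
    rw [HomCarrier.zero_apply]
    change p ^ J • n₀ c = 0
    rw [← map_nsmul, hnC c, map_zero]
  have hjθQ : p ^ j • θ.hom Q = 0 := by
    obtain ⟨k, hk⟩ := Nat.exists_eq_add_of_le hju
    have hup : ∀ d : HomCarrier C (MuCarrier (v.adicCompletion K) (p ^ J)), p ^ (u - 1).natAbs • d = 0 →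
        p ^ j • d = 0 := fun d hd ↦ by
      rw [hk, pow_add, mul_comm, mul_smul, hd, smul_zero]
    have h1 : p ^ j • (θ.hom Q - ((p ^ (J - j) : ℕ) : ℤ) • n₀) = 0 := hup _ hkill
    have h2 : p ^ j • (((p ^ (J - j) : ℕ) : ℤ) • n₀) = 0 := by
      rw [natCast_zsmul, smul_smul, ← pow_add, Nat.add_sub_cancel' hjJ, hJn₀]
    rw [smul_sub, h2, sub_zero] at h1
    exact h1
  /- `R := p^j Q ∈ C` (maximal isotropy) -/
  set R : W.geomTorsion ((p ^ J : ℕ) : ℤ) := p ^ j • Q with hRdef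
  have hRC' : R ∈ C := by
    refine mem_line_of_forall_weilPairingHom_eq_zero W p J N.plus hdiv hcard C hC e hμ hadd₁ hadd₂ halt hnondeg R
      fun S hS ↦ ?_
    have h := congrArg (fun f : HomCarrier C (MuCarrier (v.adicCompletion K) (p ^ J)) ↦ f ⟨S, hS⟩) hjθQ
    simp only [HomCarrier.zero_apply] at h
    change (p ^ j • θ.hom Q) ⟨S, hS⟩ = 0 at h
    rw [← map_nsmul, hθ_apply] at h
    exact muTransfer_injective K (v.adicCompletion K) (p ^ J) (h.trans (map_zero _).symm)
  /- (4) `R` is `u'`-twisted `Γ_K`-invariant, hence `0` by the model hypothesis -/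
  have hRfix : ∀ g : absoluteGaloisGroup K, W.twistedTorsionGaloisModule p κ J u' hu' g R = R := by
    intro g
    have h1 : W.twistedTorsionGaloisModule p κ J u' hu' g Q = Q + ((p ^ (J - j) : ℕ) : ℤ) • φ.1 g := by
      rw [hQ' g]; abel
    rw [hRdef, map_nsmul, h1, smul_add, smul_comm, natCast_zsmul, smul_smul, ← pow_add, Nat.sub_add_cancel hjJ,
      hn, add_zero]
  have hR0 : R = 0 := hmod R ((hC R).1 hRC') hRfix
  /- (5) `m := w(Q)`: `p^{J−j}(w ∘ φ') = ∂m`, `p^j m = w(R) = 0`; conclude by §1 -/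
  rw [galoisCohomology.map_one_oneCocycleClass]
  refine map_twistedTorsionInclDual_oneCocycleClass_eq_zero W p κ hjJ u hu hdivE _ (wJ Q) (fun g ↦ ?_) ?_
  · change ((p ^ (J - j) : ℕ) : ℤ) • wJ (φ.1 g) = _
    rw [← map_zsmul, hQ' g, map_sub]
    congr 1
    exact congrArg (fun L ↦ L Q) (wJ.isIntertwining' g)
  · rw [natCast_zsmul, ← map_nsmul, ← hRdef, hR0, map_zero]

end Main

end Summit.BirchSwinnertonDyer.BirchSwinnertonDyer.Theorems.MultTransportTwistedDescent

end
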